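import Summits.KontsevichZagierPeriods.KontsevichZagierPeriods.Theorems.UnfoldedStokesStokesGenerationFibrewiseRungTrilogTools
import Summits.KontsevichZagierPeriods.KontsevichZagierPeriods.Theorems.UnfoldedStokesStokesGenerationFibrewiseRungParamLanden
import Summits.KontsevichZagierPeriods.KontsevichZagierPeriods.Theorems.UnfoldedStokesStokesGenerationStubLandenLeftovers

/-!
# `StokesGeneration` (stmt-KontsevichZagierPeriods-3586), line `fibrewise_stokes` — rung 26, part B: the leftovers of the
# trilogarithm homotopy are Landen's identity with a parameter

The seven leftovers of part A (`…FibrewiseRungTrilogTools.lean`), summed with the coefficients `1, 1, 1, −1, −1, −½, −⅙` of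
`G`, equal `γ(v)·Λ_{x(v)}(s,t)` with `γ = x′/(x(1−x))` — the `v`-derivative of the weight-three identity IS Landen's weight-two
identity `Λ_a(s,t) = a/(1−ast) − a/(1−a+ast) + ½a²/((1−as)(1−at))` (value `0`) with a rational coefficient — up to three
transposition relators of `C¹` rational data (rung 12). Rung 25 (`fibStokesDecomposable_paramLanden`) supplies the family,
`landenLeft_sub_comp_perm_of_contDiffOn` the transpositions; the pointwise identity is checked with the denominators frozen.

References: L. Lewin, *Polylogarithms and associated functions* (1981), (6.10); D. Zagier, *The dilogarithm function* (2007), §I.2.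
-/

noncomputable section

-- `Summit.KontsevichZagierPeriods.KontsevichZagierPeriods.…` is the tree's mandated layout (single-conjunct summit).
set_option linter.dupNamespace false

namespace Summit.KontsevichZagierPeriods.KontsevichZagierPeriods.Cruxes.StokesGeneration.FibrewiseStokes

open MeasureTheory Set
open Literature.NumberTheory.Transcendental
open Literature.NumberTheory.Transcendental.KZ
open Literature.ModelTheory.ExponentialFields (IsSemialgebraic)

/-! ## Part B — the leftovers: Landen with the parameter `v` (rung 25) and three transpositions (rung 12) -/

/-- (B1) Rung 25 instantiated along the path: `γ(v)·Λ_{x(v)}(s,t)` with `γ = x′/(x(1−x))`, read on `[0,1]⁴` along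
`(s,t,v) = (x 0, x 1, x 3)`. [cite: Zagier2007Dilogarithm, §I.2] -/
theorem trilog_paramLanden (x₁ x₂ : ℝ) (h₁ : IsAlgebraic ℚ x₁) (h₂ : IsAlgebraic ℚ x₂)
    (h₁0 : 0 < x₁) (h₁1 : x₁ < 1) (h₂0 : 0 < x₂) (h₂1 : x₂ < 1) :
    FibStokesDecomposable 4 (fun x =>
      (x₂ - x₁) / ((x₁ + (x₂ - x₁) * x 3) * (1 - (x₁ + (x₂ - x₁) * x 3))) *
        ((x₁ + (x₂ - x₁) * x 3) / (1 - (x₁ + (x₂ - x₁) * x 3) * x 0 * x 1) -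
          (x₁ + (x₂ - x₁) * x 3) / (1 - (x₁ + (x₂ - x₁) * x 3) + (x₁ + (x₂ - x₁) * x 3) * x 0 * x 1) +
          (1 / 2) * ((-(x₁ + (x₂ - x₁) * x 3) / (1 - (x₁ + (x₂ - x₁) * x 3) * x 0)) *
            (-(x₁ + (x₂ - x₁) * x 3) / (1 - (x₁ + (x₂ - x₁) * x 3) * x 1))))) := by
  set d : ℝ := x₂ - x₁ with hd
  have hdA : IsAlgebraic ℚ d := h₂.sub h₁
  -- a rational margin `q` with `|d|·q < m/2`, `m` = distance of `{x₁, x₂}` from `{0, 1}`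
  set m : ℝ := min (min x₁ x₂) (min (1 - x₁) (1 - x₂)) with hm
  have hm0 : 0 < m := by simp only [hm, lt_min_iff]; exact ⟨⟨h₁0, h₂0⟩, by linarith, by linarith⟩
  have hm1 : m ≤ x₁ := by simp only [hm]; exact (min_le_left _ _).trans (min_le_left _ _)
  have hm2 : m ≤ x₂ := by simp only [hm]; exact (min_le_left _ _).trans (min_le_right _ _)
  have hm3 : m ≤ 1 - x₁ := by simp only [hm]; exact (min_le_right _ _).trans (min_le_left _ _)
  have hm4 : m ≤ 1 - x₂ := by simp only [hm]; exact (min_le_right _ _).trans (min_le_right _ _)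
  obtain ⟨q, hq0, hq1⟩ := exists_rat_btwn (show (0:ℝ) < m / (2 * (|d| + 1)) by positivity)
  have hq0' : (0:ℝ) < q := by exact_mod_cast hq0
  have hdq : |d| * q < m / 2 := by
    have h1 : |d| * (q:ℝ) ≤ (|d| + 1) * q := by nlinarith [abs_nonneg d]
    have h2 : (|d| + 1) * (q:ℝ) < (|d| + 1) * (m / (2 * (|d| + 1))) := by
      exact mul_lt_mul_of_pos_left hq1 (by positivity)
    have h3 : (|d| + 1) * (m / (2 * (|d| + 1))) = m / 2 := by field_simp
    linarith
  -- the path stays in `(0,1)` on the enlarged interval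
  have hA : ∀ v ∈ Set.Ioo (-(q:ℝ)) (1 + q), 0 < x₁ + d * v ∧ x₁ + d * v < 1 := by
    intro v hv
    have hdv : ∀ w : ℝ, |w| ≤ q → |d * w| < m / 2 := fun w hw => by
      rw [abs_mul]; exact lt_of_le_of_lt (mul_le_mul_of_nonneg_left hw (abs_nonneg d)) hdq
    rcases lt_or_ge v 0 with hv0 | hv0
    · have h := abs_lt.mp (hdv v (abs_le.mpr ⟨by linarith [hv.1], by linarith⟩))
      constructor <;> linarith
    rcases le_or_gt v 1 with hv1 | hv1
    · have := trilog_path_mem h₁0 h₁1 h₂0 h₂1 v ⟨hv0, hv1⟩; exact this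
    · have h := abs_lt.mp (hdv (v - 1) (abs_le.mpr ⟨by linarith, by linarith [hv.2]⟩))
      have e : x₁ + d * v = x₂ + d * (v - 1) := by rw [hd]; ring
      rw [e]; constructor <;> linarith
  -- the semialgebraic slab `S = {z | z 0 ∈ (−q, 1+q)}`
  set S : Set (Fin 1 → ℝ) := {z | z 0 ∈ Set.Ioo (-(q:ℝ)) (1 + q)} with hS
  have hqA : IsAlgebraic ℚ (q:ℝ) := isAlgebraic_algebraMap q
  have hSsa : IsSemialgebraic ℚ S := by
    have hV : IsSemialgebraic ℚ (Set.univ : Set (Fin 1 → ℝ)) :=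
      Literature.ModelTheory.ExponentialFields.isSemialgebraic_univ
    have u0 : IsSemialgebraicFunOn ℚ (Set.univ : Set (Fin 1 → ℝ)) (fun z => z 0) := isSemialgebraicFunOn_apply hV 0
    have n1 := ((isSemialgebraicFunOn_const_of_isAlgebraic hV hqA.neg).fun_sub u0).isSemialgebraic_sep_neg
    have n2 := (u0.fun_sub (isSemialgebraicFunOn_const_of_isAlgebraic hV
      (isAlgebraic_one.add hqA))).isSemialgebraic_sep_neg
    rw [hS]
    convert n1.inter n2 using 1
    ext z
    simp only [Set.mem_setOf_eq, Set.mem_Ioo, Set.mem_inter_iff, Set.mem_univ, true_and, sub_neg]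
  have sA : IsSemialgebraicFunOn ℚ S (fun z => x₁ + d * z 0) :=
    (isSemialgebraicFunOn_const_of_isAlgebraic hSsa h₁).fun_add
      ((isSemialgebraicFunOn_const_of_isAlgebraic hSsa hdA).fun_mul (isSemialgebraicFunOn_apply hSsa 0))
  have hSne : ∀ z ∈ S, (x₁ + d * z 0) * (1 - (x₁ + d * z 0)) ≠ 0 := by
    intro z hz; rw [hS] at hz
    have h := hA (z 0) hz
    exact mul_ne_zero h.1.ne' (by linarith [h.2])
  have sγ : IsSemialgebraicFunOn ℚ S (fun z => d / ((x₁ + d * z 0) * (1 - (x₁ + d * z 0)))) :=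
    (isSemialgebraicFunOn_const_of_isAlgebraic hSsa hdA).div
      (sA.fun_mul ((isSemialgebraicFunOn_const_of_isAlgebraic hSsa isAlgebraic_one).fun_sub sA)) hSne
  have hAc : ContDiffOn ℝ 1 (fun v => x₁ + d * v) (Set.Ioo (-(q:ℝ)) (1 + q)) := by
    have : ContDiff ℝ 1 (fun v : ℝ => x₁ + d * v) := by fun_prop
    exact this.contDiffOn
  have hγc : ContDiffOn ℝ 1 (fun v => d / ((x₁ + d * v) * (1 - (x₁ + d * v)))) (Set.Ioo (-(q:ℝ)) (1 + q)) := by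
    refine ContDiffOn.div contDiffOn_const (hAc.mul (contDiffOn_const.sub hAc)) fun v hv => ?_
    have h := hA v hv
    exact mul_ne_zero h.1.ne' (by linarith [h.2])
  have PL := fibStokesDecomposable_paramLanden (fun v => x₁ + d * v)
    (fun v => d / ((x₁ + d * v) * (1 - (x₁ + d * v)))) q hq0' sA sγ hAc hγc (fun v hv => (hA v hv).2)
  have hle : 3 ≤ 4 := by norm_num
  have hpad := fibStokesDecomposable_pad 3 4 hle _ PL
  have hperm := fibStokesDecomposable_perm 4 (Equiv.swap (2 : Fin 4) 3) _ hpad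
  refine fibStokesDecomposable_congr_off_null 4 _ _ ∅
    Literature.ModelTheory.ExponentialFields.isSemialgebraic_empty measure_empty (fun x _ _ => ?_) hperm
  have e0 : (fun l => x ((Equiv.swap (2 : Fin 4) 3) l)) (Fin.castLE hle 0) = x 0 := rfl
  have e1 : (fun l => x ((Equiv.swap (2 : Fin 4) 3) l)) (Fin.castLE hle 1) = x 1 := rfl
  have e2 : (fun l => x ((Equiv.swap (2 : Fin 4) 3) l)) (Fin.castLE hle 2) = x 3 := rfl
  simp only [e0, e1, e2]

/-- (B2) **The leftovers of rung 26 are decomposable.** The seven one-weight-down leftovers of the homotopy (A1–A7), summed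
with their coefficients `1, 1, 1, −1, −1, −½, −⅙`, equal `γ(v)·Λ_{x(v)}(s,t)` (`γ = x′/(x(1−x))`: the derivative of the
weight-three identity IS Landen's identity) up to three transposition relators with `C¹` rational coefficients
(`c₀₂ = x′(1/x + 1/(6(1−x)))` on `λ(s)λ(u) − λ(s)λ(t)`, `c₁₂ = x′(−1/(2x) + 1/(6(1−x)))` on `λ(t)λ(u) − λ(s)λ(t)`,
`e = −x′/(2(1−x))` on `κ(s)λ(u) − κ(s)λ(t)`; `λ(r) = −x/(1−xr)`, `κ(r) = −(1−x)/(1−(1−x)r)`), hence are decomposable by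
rung 25 (B1) and rung 12. [cite: Zagier2007Dilogarithm, §I.2] -/
theorem trilog_leftovers (x₁ x₂ : ℝ) (h₁ : IsAlgebraic ℚ x₁) (h₂ : IsAlgebraic ℚ x₂)
    (h₁0 : 0 < x₁) (h₁1 : x₁ < 1) (h₂0 : 0 < x₂) (h₂1 : x₂ < 1) :
    FibStokesDecomposable 4 (fun x =>
      -- (1) + (2) + (3): the three `Li₃` leftovers
      (x₂ - x₁) / (1 - (x₁ + (x₂ - x₁) * x 3) * x 0 * x 1) +
      -(x₂ - x₁) / (1 - (1 - (x₁ + (x₂ - x₁) * x 3)) * x 0 * x 1) +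
      (-(x₂ - x₁) / (1 - (x₁ + (x₂ - x₁) * x 3)) ^ 2) /
          (1 - (-(x₁ + (x₂ - x₁) * x 3) / (1 - (x₁ + (x₂ - x₁) * x 3))) * x 0 * x 1) -
      -- (4), (5): the `log(1−x)·Li₂` leftovers
      ((-(x₂ - x₁) / (1 - (x₁ + (x₂ - x₁) * x 3))) *
            ((x₁ + (x₂ - x₁) * x 3) / (1 - (x₁ + (x₂ - x₁) * x 3) * x 0 * x 1)) +
          (-(x₁ + (x₂ - x₁) * x 3) / (1 - (x₁ + (x₂ - x₁) * x 3) * x 2)) *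
            ((x₂ - x₁) / (1 - (x₁ + (x₂ - x₁) * x 3) * x 0))) -
      ((-(x₂ - x₁) / (1 - (x₁ + (x₂ - x₁) * x 3))) *
            ((1 - (x₁ + (x₂ - x₁) * x 3)) / (1 - (1 - (x₁ + (x₂ - x₁) * x 3)) * x 0 * x 1)) +
          (-(x₁ + (x₂ - x₁) * x 3) / (1 - (x₁ + (x₂ - x₁) * x 3) * x 2)) *
            (-(x₂ - x₁) / (1 - (1 - (x₁ + (x₂ - x₁) * x 3)) * x 0))) -
      -- (6): `−½ κλλ`
      (1 / 2) * (((x₂ - x₁) / (1 - (1 - (x₁ + (x₂ - x₁) * x 3)))) *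
              (-(x₁ + (x₂ - x₁) * x 3) / (1 - (x₁ + (x₂ - x₁) * x 3) * x 1)) *
            (-(x₁ + (x₂ - x₁) * x 3) / (1 - (x₁ + (x₂ - x₁) * x 3) * x 2)) +
          (-(1 - (x₁ + (x₂ - x₁) * x 3)) / (1 - (1 - (x₁ + (x₂ - x₁) * x 3)) * x 0)) *
              (-(x₂ - x₁) / (1 - (x₁ + (x₂ - x₁) * x 3))) *
            (-(x₁ + (x₂ - x₁) * x 3) / (1 - (x₁ + (x₂ - x₁) * x 3) * x 2)) +
          (-(1 - (x₁ + (x₂ - x₁) * x 3)) / (1 - (1 - (x₁ + (x₂ - x₁) * x 3)) * x 0)) *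
              (-(x₁ + (x₂ - x₁) * x 3) / (1 - (x₁ + (x₂ - x₁) * x 3) * x 1)) *
            (-(x₂ - x₁) / (1 - (x₁ + (x₂ - x₁) * x 3)))) -
      -- (7): `−⅙ λλλ`
      (1 / 6) * ((-(x₂ - x₁) / (1 - (x₁ + (x₂ - x₁) * x 3))) *
              (-(x₁ + (x₂ - x₁) * x 3) / (1 - (x₁ + (x₂ - x₁) * x 3) * x 1)) *
            (-(x₁ + (x₂ - x₁) * x 3) / (1 - (x₁ + (x₂ - x₁) * x 3) * x 2)) +
          (-(x₁ + (x₂ - x₁) * x 3) / (1 - (x₁ + (x₂ - x₁) * x 3) * x 0)) *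
              (-(x₂ - x₁) / (1 - (x₁ + (x₂ - x₁) * x 3))) *
            (-(x₁ + (x₂ - x₁) * x 3) / (1 - (x₁ + (x₂ - x₁) * x 3) * x 2)) +
          (-(x₁ + (x₂ - x₁) * x 3) / (1 - (x₁ + (x₂ - x₁) * x 3) * x 0)) *
              (-(x₁ + (x₂ - x₁) * x 3) / (1 - (x₁ + (x₂ - x₁) * x 3) * x 1)) *
            (-(x₂ - x₁) / (1 - (x₁ + (x₂ - x₁) * x 3))))) := by
  set d : ℝ := x₂ - x₁ with hd
  have hdA : IsAlgebraic ℚ d := h₂.sub h₁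
  -- an open semialgebraic neighbourhood of the cube on which all data are `C¹`
  obtain ⟨U, hU⟩ : ∃ U : Set (Fin 4 → ℝ), U = {z | 0 < x₁ + d * z 3 ∧ 0 < 1 - (x₁ + d * z 3) ∧
      0 < 1 - (x₁ + d * z 3) * z 0 ∧ 0 < 1 - (x₁ + d * z 3) * z 1 ∧ 0 < 1 - (x₁ + d * z 3) * z 2 ∧
      0 < 1 - (1 - (x₁ + d * z 3)) * z 0} := ⟨_, rfl⟩
  have hUo : IsOpen U := by
    have cA : Continuous fun z : Fin 4 → ℝ => x₁ + d * z 3 := by fun_prop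
    have cA' : Continuous fun z : Fin 4 → ℝ => 1 - (x₁ + d * z 3) := by fun_prop
    have c0 : Continuous fun z : Fin 4 → ℝ => 1 - (x₁ + d * z 3) * z 0 := by fun_prop
    have c1 : Continuous fun z : Fin 4 → ℝ => 1 - (x₁ + d * z 3) * z 1 := by fun_prop
    have c2 : Continuous fun z : Fin 4 → ℝ => 1 - (x₁ + d * z 3) * z 2 := by fun_prop
    have c0' : Continuous fun z : Fin 4 → ℝ => 1 - (1 - (x₁ + d * z 3)) * z 0 := by fun_prop
    rw [hU]
    exact (isOpen_lt continuous_const cA).inter ((isOpen_lt continuous_const cA').inter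
      ((isOpen_lt continuous_const c0).inter ((isOpen_lt continuous_const c1).inter
      ((isOpen_lt continuous_const c2).inter (isOpen_lt continuous_const c0')))))
  have hUsa : IsSemialgebraic ℚ U := by
    have hV : IsSemialgebraic ℚ (Set.univ : Set (Fin 4 → ℝ)) :=
      Literature.ModelTheory.ExponentialFields.isSemialgebraic_univ
    have ux' : ∀ i, IsSemialgebraicFunOn ℚ (Set.univ : Set (Fin 4 → ℝ)) (fun z => z i) := fun i =>
      isSemialgebraicFunOn_apply hV i
    have uone : IsSemialgebraicFunOn ℚ (Set.univ : Set (Fin 4 → ℝ)) (fun _ => (1:ℝ)) := by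
      simpa using isSemialgebraicFunOn_const_natCast hV 1
    have uA := (isSemialgebraicFunOn_const_of_isAlgebraic hV h₁).fun_add
      ((isSemialgebraicFunOn_const_of_isAlgebraic hV hdA).fun_mul (ux' 3))
    have n0 := uA.fun_neg.isSemialgebraic_sep_neg
    have n1 := (uA.fun_sub uone).isSemialgebraic_sep_neg
    have n2 := ((uA.fun_mul (ux' 0)).fun_sub uone).isSemialgebraic_sep_neg
    have n3 := ((uA.fun_mul (ux' 1)).fun_sub uone).isSemialgebraic_sep_neg
    have n4 := ((uA.fun_mul (ux' 2)).fun_sub uone).isSemialgebraic_sep_neg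
    have n5 := (((uone.fun_sub uA).fun_mul (ux' 0)).fun_sub uone).isSemialgebraic_sep_neg
    rw [hU]
    convert n0.inter (n1.inter (n2.inter (n3.inter (n4.inter n5)))) using 1
    ext z
    simp only [Set.mem_setOf_eq, Set.mem_inter_iff, Set.mem_univ, true_and, sub_pos, sub_neg, neg_neg_iff_pos]
  have hCU : Set.pi Set.univ (fun _ : Fin 4 => Set.Icc (0:ℝ) 1) ⊆ U := by
    intro z hz
    have hm : ∀ i, z i ∈ Set.Icc (0:ℝ) 1 := fun i => (Set.mem_univ_pi.mp hz) i
    have hx := trilog_path_mem h₁0 h₁1 h₂0 h₂1 (z 3) (hm 3)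
    rw [hU]
    refine ⟨hx.1, by linarith [hx.2], ?_, ?_, ?_, ?_⟩
    · nlinarith [mul_nonneg hx.1.le (hm 0).1, (hm 0).2]
    · nlinarith [mul_nonneg hx.1.le (hm 1).1, (hm 1).2]
    · nlinarith [mul_nonneg hx.1.le (hm 2).1, (hm 2).2]
    · nlinarith [mul_nonneg (sub_nonneg.2 hx.2.le) (hm 0).1, (hm 0).2]
  have hDA : ∀ z ∈ U, x₁ + d * z 3 ≠ 0 := fun z hz => by rw [hU] at hz; exact hz.1.ne'
  have hDA' : ∀ z ∈ U, 1 - (x₁ + d * z 3) ≠ 0 := fun z hz => by rw [hU] at hz; exact hz.2.1.ne'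
  have hD0 : ∀ z ∈ U, 1 - (x₁ + d * z 3) * z 0 ≠ 0 := fun z hz => by rw [hU] at hz; exact hz.2.2.1.ne'
  have hD1 : ∀ z ∈ U, 1 - (x₁ + d * z 3) * z 1 ≠ 0 := fun z hz => by rw [hU] at hz; exact hz.2.2.2.1.ne'
  have hD2 : ∀ z ∈ U, 1 - (x₁ + d * z 3) * z 2 ≠ 0 := fun z hz => by rw [hU] at hz; exact hz.2.2.2.2.1.ne'
  have hD0' : ∀ z ∈ U, 1 - (1 - (x₁ + d * z 3)) * z 0 ≠ 0 := fun z hz => by rw [hU] at hz; exact hz.2.2.2.2.2.ne'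
  have hN6 : ∀ z ∈ U, 6 * (1 - (x₁ + d * z 3)) ≠ 0 := fun z hz => mul_ne_zero (by norm_num) (hDA' z hz)
  have hN2 : ∀ z ∈ U, 2 * (x₁ + d * z 3) ≠ 0 := fun z hz => mul_ne_zero (by norm_num) (hDA z hz)
  have hN2' : ∀ z ∈ U, 2 * (1 - (x₁ + d * z 3)) ≠ 0 := fun z hz => mul_ne_zero (by norm_num) (hDA' z hz)
  have ux : ∀ i, IsSemialgebraicFunOn ℚ U (fun z => z i) := fun i => isSemialgebraicFunOn_apply hUsa i
  have ucst : ∀ {t : ℝ}, IsAlgebraic ℚ t → IsSemialgebraicFunOn ℚ U (fun _ => t) :=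
    fun ht => isSemialgebraicFunOn_const_of_isAlgebraic hUsa ht
  have uone : IsSemialgebraicFunOn ℚ U (fun _ => (1:ℝ)) := by simpa using isSemialgebraicFunOn_const_natCast hUsa 1
  have uA : IsSemialgebraicFunOn ℚ U (fun z => x₁ + d * z 3) := (ucst h₁).fun_add ((ucst hdA).fun_mul (ux 3))
  have h2A : IsAlgebraic ℚ (2:ℝ) := by simpa using isAlgebraic_algebraMap (R := ℚ) (A := ℝ) 2
  have h6A : IsAlgebraic ℚ (6:ℝ) := by simpa using isAlgebraic_algebraMap (R := ℚ) (A := ℝ) 6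
  -- the `λ`'s and `κ` on `U`
  have uL : ∀ i, i ≠ 3 → (∀ z ∈ U, 1 - (x₁ + d * z 3) * z i ≠ 0) →
      IsSemialgebraicFunOn ℚ U (fun z => -(x₁ + d * z 3) / (1 - (x₁ + d * z 3) * z i)) :=
    fun i _ hne => uA.fun_neg.div (uone.fun_sub (uA.fun_mul (ux i))) hne
  have uK : IsSemialgebraicFunOn ℚ U (fun z => -(1 - (x₁ + d * z 3)) / (1 - (1 - (x₁ + d * z 3)) * z 0)) :=
    (uone.fun_sub uA).fun_neg.div (uone.fun_sub ((uone.fun_sub uA).fun_mul (ux 0))) hD0'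
  -- coefficient functions
  have uc02 : IsSemialgebraicFunOn ℚ U (fun z => d / (x₁ + d * z 3) + d / (6 * (1 - (x₁ + d * z 3)))) :=
    ((ucst hdA).div uA hDA).fun_add ((ucst hdA).div ((ucst h6A).fun_mul (uone.fun_sub uA)) hN6)
  have uc12 : IsSemialgebraicFunOn ℚ U (fun z => -d / (2 * (x₁ + d * z 3)) + d / (6 * (1 - (x₁ + d * z 3)))) :=
    ((ucst hdA).fun_neg.div ((ucst h2A).fun_mul uA) hN2).fun_add
      ((ucst hdA).div ((ucst h6A).fun_mul (uone.fun_sub uA)) hN6)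
  have ue : IsSemialgebraicFunOn ℚ U (fun z => -d / (2 * (1 - (x₁ + d * z 3)))) :=
    (ucst hdA).fun_neg.div ((ucst h2A).fun_mul (uone.fun_sub uA)) hN2'
  -- the three transposition relators
  have T1 := landenLeft_sub_comp_perm_of_contDiffOn U hUo hCU
    (fun z => (d / (x₁ + d * z 3) + d / (6 * (1 - (x₁ + d * z 3)))) *
      (-(x₁ + d * z 3) / (1 - (x₁ + d * z 3) * z 0)) * (-(x₁ + d * z 3) / (1 - (x₁ + d * z 3) * z 2)))
    ((uc02.fun_mul (uL 0 (by decide) hD0)).fun_mul (uL 2 (by decide) hD2))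
    (by fun_prop (disch := assumption)) (Equiv.swap 1 2)
  have T2 := landenLeft_sub_comp_perm_of_contDiffOn U hUo hCU
    (fun z => (-d / (2 * (x₁ + d * z 3)) + d / (6 * (1 - (x₁ + d * z 3)))) *
      (-(x₁ + d * z 3) / (1 - (x₁ + d * z 3) * z 1)) * (-(x₁ + d * z 3) / (1 - (x₁ + d * z 3) * z 2)))
    ((uc12.fun_mul (uL 1 (by decide) hD1)).fun_mul (uL 2 (by decide) hD2))
    (by fun_prop (disch := assumption)) (Equiv.swap 0 2)
  have T3 := landenLeft_sub_comp_perm_of_contDiffOn U hUo hCU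
    (fun z => (-d / (2 * (1 - (x₁ + d * z 3)))) *
      (-(1 - (x₁ + d * z 3)) / (1 - (1 - (x₁ + d * z 3)) * z 0)) * (-(x₁ + d * z 3) / (1 - (x₁ + d * z 3) * z 2)))
    ((ue.fun_mul uK).fun_mul (uL 2 (by decide) hD2))
    (by fun_prop (disch := assumption)) (Equiv.swap 1 2)
  have PL := trilog_paramLanden x₁ x₂ h₁ h₂ h₁0 h₁1 h₂0 h₂1
  have hS := fibStokesDecomposable_add 4 _ _ (fibStokesDecomposable_add 4 _ _
    (fibStokesDecomposable_add 4 _ _ PL T1) T2) T3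
  refine fibStokesDecomposable_congr_off_null 4 _ _ ∅
    Literature.ModelTheory.ExponentialFields.isSemialgebraic_empty measure_empty (fun z hz _ => ?_) hS
  have hzU : z ∈ U := hCU hz
  rw [hU] at hzU
  obtain ⟨dA, dA', d0, d1, d2, d0'⟩ := hzU
  have n10 : (0 : Fin 4) ≠ 1 := by decide
  have n20 : (0 : Fin 4) ≠ 2 := by decide
  have n31 : (3 : Fin 4) ≠ 1 := by decide
  have n32 : (3 : Fin 4) ≠ 2 := by decide
  have n30 : (3 : Fin 4) ≠ 0 := by decide
  have n12 : (1 : Fin 4) ≠ 2 := by decide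
  simp only [Equiv.swap_apply_right, Equiv.swap_apply_of_ne_of_ne n10 n20,
    Equiv.swap_apply_of_ne_of_ne n31 n32, Equiv.swap_apply_of_ne_of_ne n30 n32,
    Equiv.swap_apply_of_ne_of_ne n10.symm n12]
  clear hS T1 T2 T3 PL uL uK uc02 uc12 ue ux uone uA hUsa hUo hCU
  have hA0 : x₁ + d * z 3 ≠ 0 := dA.ne'
  have hA1 : 1 - (x₁ + d * z 3) ≠ 0 := dA'.ne'
  have h01 : 1 - (x₁ + d * z 3) * z 0 * z 1 ≠ 0 := by
    have hm : ∀ i, z i ∈ Set.Icc (0:ℝ) 1 := fun i => (Set.mem_univ_pi.mp hz) i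
    have hp := trilog_prod_mem hz 0 1
    have := (trilog_den_pos h₁0 h₁1 h₂0 h₂1 (hm 3) hp.2).1
    rw [hd]; rw [mul_assoc]; exact this.ne'
  have h01' : 1 - (1 - (x₁ + d * z 3)) * z 0 * z 1 ≠ 0 := by
    have hm : ∀ i, z i ∈ Set.Icc (0:ℝ) 1 := fun i => (Set.mem_univ_pi.mp hz) i
    have hp := trilog_prod_mem hz 0 1
    have := (trilog_den_pos h₁0 h₁1 h₂0 h₂1 (hm 3) hp.2).2
    rw [hd]; rw [mul_assoc]; exact this.ne'
  have h01w : 1 - (x₁ + d * z 3) + (x₁ + d * z 3) * z 0 * z 1 ≠ 0 := by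
    have hm : ∀ i, z i ∈ Set.Icc (0:ℝ) 1 := fun i => (Set.mem_univ_pi.mp hz) i
    have hp := trilog_prod_mem hz 0 1
    have hq : 1 - z 0 * z 1 ≤ 1 := by linarith [hp.1]
    have := (trilog_den_pos h₁0 h₁1 h₂0 h₂1 (hm 3) hq).1
    rw [hd]; intro h; apply this.ne'; linear_combination h
  have hw3 : 1 - -(x₁ + d * z 3) / (1 - (x₁ + d * z 3)) * z 0 * z 1 ≠ 0 := by
    have e : 1 - -(x₁ + d * z 3) / (1 - (x₁ + d * z 3)) * z 0 * z 1 =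
        (1 - (x₁ + d * z 3) + (x₁ + d * z 3) * z 0 * z 1) / (1 - (x₁ + d * z 3)) := by
      field_simp; ring
    rw [e]; exact div_ne_zero h01w hA1
  rw [hd] at hA0 hA1 h01 h01' h01w hw3 d0 d1 d2 d0'
  rw [hd]
  set A : ℝ := x₁ + (x₂ - x₁) * z 3 with hAdef
  have hd0 : (1 - A * z 0) ≠ 0 := d0.ne'
  have hd1 : (1 - A * z 1) ≠ 0 := d1.ne'
  have hd2 : (1 - A * z 2) ≠ 0 := d2.ne'
  have hd0' : (1 - (1 - A) * z 0) ≠ 0 := d0'.ne'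
  -- normal forms: the compound `Li₃(−x/(1−x))` leftover and `1 − (1 − A)`
  have r3 : -(x₂ - x₁) / (1 - A) ^ 2 / (1 - -A / (1 - A) * z 0 * z 1) =
      -(x₂ - x₁) / ((1 - A) * (1 - A + A * z 0 * z 1)) := by
    have e3 : 1 - -A / (1 - A) * z 0 * z 1 = (1 - A + A * z 0 * z 1) / (1 - A) := by
      field_simp
      ring
    rw [e3, div_div_eq_mul_div, div_eq_div_iff (by exact h01w) (mul_ne_zero hA1 h01w)]
    field_simp
  have r4 : (1:ℝ) - (1 - A) = A := by ring
  rw [r3, r4]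
  -- freeze the denominators, then clear the remaining (few) divisions
  generalize hP1 : 1 - A * z 0 * z 1 = P1 at h01 ⊢
  generalize hP2 : 1 - (1 - A) * z 0 * z 1 = P2 at h01' ⊢
  generalize hP3 : 1 - A + A * z 0 * z 1 = P3 at h01w ⊢
  generalize hQ0 : 1 - A * z 0 = Q0 at hd0 ⊢
  generalize hQ1 : 1 - A * z 1 = Q1 at hd1 ⊢
  generalize hQ2 : 1 - A * z 2 = Q2 at hd2 ⊢
  generalize hR0 : 1 - (1 - A) * z 0 = R0 at hd0' ⊢
  field_simp
  ring


end Summit.KontsevichZagierPeriods.KontsevichZagierPeriods.Cruxes.StokesGeneration.FibrewiseStokes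

end
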